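import Summits.QuantumFields.BalabanUV.T4Continuum.Support.SkeletonFillFullRootCorner
import Summits.QuantumFields.BalabanUV.T4Continuum.Support.SkeletonFillFullGradReduce

/-!
# T⁴ programme, node NE3 — kinematic refinement lemma, leaf R1c∕R1d (row NE3-S4d): **THE COVARIANT FLUX GRADIENT OF
# THE CLOSED-FORM FILLING AT EVERY BOND AND PLANE** (file F4e `SkeletonFillFullCovGrad` — the END of the F4 chain)

Cell `pub-balaban`, NE3 formalisation swarm `b2b-balaban-t4-ne3-formalise-*`, unit `b2b-balaban-t4-ne3-formalise-leaf-04`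
(LEAF PROVER 04, gen 2), for row **S4d** of `t4/formal/NE3/LEAVES.md` BY ARRANGEMENT with its holder leaf-07 (journal
«F3-GRAD SPLIT» ∕ «F3-GRAD PLAN v1», typer ruling ρ12, 2026-08-20).  SOCKET: the flux-gradient field of the owner's
`SmoothRefineOfApprox.ApproxRefine` for `W := fullFill L T h` ∕ hypothesis `hρ` of leaf-09's
`ApproxRefineGradReduce.approxRefine_of_rootClose` («R1 waits on ONE number: the root-closeness radius ρ»).

CONTENT (all [folklore]; `Matrix n n ℂ`; 0 sorry):
§1 **`norm_plaq_sub_root_le`** — THE FOUR CASES UNDER ONE ROOF: for unitary data with roots within `a₀` of `1`, covariant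
   root gradients `≤ δ` across every coarse bond and the root identity `h^{L²} = T(∂p)`, EVERY fine plaquette of the filling
   (corner `L•z + q`, `q ∈ [0,L)^d`, plane `μ < ν`) is within
   **`ρ⋆ = 2d(L−1)δ + 2d(L−1)Lδ + 14·S²`**, `S = d(L−1)a₀ + d(L−1)La₀ + L²a₀`, of ITS CELL'S ROOT `h(z;μ,ν)` — cases I∕II
   (`SkeletonFillFullRoot`), III (`SkeletonFillFullRootFar`), IV (`SkeletonFillFullRootCorner`) dominated exactly as leaf-07's
   F3d `SkeletonFillFullSmallField.norm_plaq_lt_sub_one_le` dominates the radius; NO term linear in `a₀` (the radius has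
   `a₀ + …`, the root-closeness has none); `norm_plaq_sub_root_le'` is the same at an arbitrary site `x`;
§2 **`covGrad_fullFill_le`** — THE END: `∀ x κ π, ‖covGrad W (flux W) x κ π‖ ≤ 4(θ + θ_L)(a₀ + ρ⋆ + δ) + 2(2ρ⋆ + δ)`
   (`θ = d(L−1)a₀`, `θ_L = d(L−1)La₀`) under `a₀ + ρ⋆ + δ ≤ 1/2`, by `SkeletonFillFullGradReduce.covGrad_fullFill_le_of_rootClose`
   (F4a) with `hroot := §1` — second order in `a₀` plus first order in the covariant root gradient `δ`, i.e. the SHAPE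
   `t4/formal/NE3/Statements/S4d-SHAPE-v1.md` §3 line «`≤ C₃(d,L)·δ + C₄(d,L)·a₀²`» with explicit polynomial constants.

HONEST FRAMING.  Norm bookkeeping for a kinematic construction (one configuration, one refinement step); no minimiser, no
variational problem, no conditional of the cell (`BetaPertH`, (B), G-an2-4); nothing here bears on infinite volume, a mass
gap, or the Clay problem; **NE3 is NOT proved**; `SmoothRefine` ∕ `ApproxRefine` NOT proved here (leaf-09's part 3c
instantiates `(a₀, δ)` from `ApproxRefineRootData.rootData_precomp` and closes `approxRefine_sfClass`; the route-(A) END stays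
«NE3-(A) CONDITIONAL on (H∃)∕(H3ˢᵘᵖ)»).  Finite T⁴ rung (B)+1.  ABSOLUTE RULE kept: no printed sentence is a hypothesis;
no `def … : Prop` fact; no `sorry`; axioms ⊆ {propext, Classical.choice, Quot.sound}.  PLACEMENT (human rule 2026-08-19):
under `Summits/QuantumFields/BalabanUV/`; imports F4d + F4a; restates nothing.
HONEST DEPENDENCY: continuum YM on T⁴ ⇐ BetaPertH ∧ nine spine estimates (0/9 proved); BetaPertH ⇐ (D1) ∧ (D4) ∧ CAP+tail;
G-an2-4 gates asym, D1 and NE2/3/4.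
-/

set_option autoImplicit false

open scoped BigOperators Matrix Matrix.Norms.L2Operator
open NormedSpace

namespace Summit.QuantumFields.BalabanUV.T4Continuum.SkeletonFillFullCovGrad

open Literature.MathematicalPhysics.QuantumFieldTheory.Balaban1983to89
open B7Prop1Explicit B7Prop2Explicit B7Prop1Local MatrixLog UnitaryModel
open T4AveragingDeficitWall hiding Site Plane Plaq Bond
open AveragingDeficitTransport AveragingDeficitNearIdentity GaugeFieldPerturbation
open SkeletonLattice SkeletonFill SkeletonFillFull SkeletonFillFullNorms SkeletonFillFullFaces
open SkeletonFillFullRoot SkeletonFillFullRootFar SkeletonFillFullRootCorner SkeletonFillFullGradReduce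

noncomputable section

variable {d : ℕ} {n : Type*} [Fintype n] [DecidableEq n]

section End

variable [Nonempty n] {L : ℕ} {a₀ δ : ℝ}

/-- **ROOT-CLOSENESS, THE FOUR CASES UNDER ONE ROOF** (`μ < ν`, corner `L•z + q`, `q ∈ [0,L)^d`): every fine plaquette of
the filling is within `2d(L−1)δ + 2d(L−1)Lδ + 14S²` of its cell's root `h(z;μ,ν)`, `S = d(L−1)a₀ + d(L−1)La₀ + L²a₀`.
[folklore] -/
theorem norm_plaq_sub_root_le (hL : 1 ≤ L) {T : Site d → Fin d → (Matrix n n ℂ)ˣ}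
    {h : Site d → Fin d → Fin d → (Matrix n n ℂ)ˣ}
    (hT : ∀ (z : Site d) (κ : Fin d), T z κ ∈ unitaryUnits (Matrix n n ℂ))
    (hh : ∀ (z : Site d) (κ ν : Fin d), h z κ ν ∈ unitaryUnits (Matrix n n ℂ))
    (ha : ∀ (z : Site d) (κ ν : Fin d), κ < ν → ‖((h z κ ν : (Matrix n n ℂ)ˣ) : Matrix n n ℂ) - 1‖ ≤ a₀) (ha0 : 0 ≤ a₀)
    (hδ : ∀ (z : Site d) (ρ κ ι : Fin d), κ < ι →
      ‖((T z ρ * h (z + e ρ) κ ι * (T z ρ)⁻¹ : (Matrix n n ℂ)ˣ) : Matrix n n ℂ) - ((h z κ ι : (Matrix n n ℂ)ˣ) : Matrix n n ℂ)‖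
        ≤ δ) (hδ0 : 0 ≤ δ)
    (hroot : ∀ (z : Site d) (κ ι : Fin d), κ < ι → (h z κ ι) ^ (L * L) = hol T z (plaqWord κ ι))
    (z : Site d) {q : Site d} (hq : InBox L q) {μ ν : Fin d} (hμν : μ < ν) :
    ‖((hol (fullFill L T h) ((L : ℤ) • z + q) (plaqWord μ ν) : (Matrix n n ℂ)ˣ) : Matrix n n ℂ)
        - ((h z μ ν : (Matrix n n ℂ)ˣ) : Matrix n n ℂ)‖
      ≤ 2 * (d * ((L - 1 : ℕ) * δ)) + 2 * (d * (((L - 1 : ℕ) * L) * δ))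
        + 14 * (d * ((L - 1 : ℕ) * a₀) + d * (((L - 1 : ℕ) * L) * a₀) + L * L * a₀) ^ 2 := by
  -- the common comparison constants (as in F3d)
  set θ : ℝ := d * ((L - 1 : ℕ) * a₀) with hθdef
  set θL : ℝ := d * (((L - 1 : ℕ) * L) * a₀) with hθLdef
  set S : ℝ := θ + θL + L * L * a₀ with hSdef
  have hLr : (1 : ℝ) ≤ L := by exact_mod_cast hL
  have hL1r : ((L - 1 : ℕ) : ℝ) ≤ L := by exact_mod_cast Nat.sub_le L 1
  have hθ0 : 0 ≤ θ := by positivity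
  have hθL0 : 0 ≤ θL := by positivity
  have hLLa : 0 ≤ (L : ℝ) * L * a₀ := by positivity
  have hS0 : 0 ≤ S := by positivity
  have hLL1 : ((L - 1 : ℕ) : ℝ) ≤ L * L := hL1r.trans (by nlinarith)
  have hLL2 : (L : ℝ) ≤ L * L := by nlinarith
  have hLL3 : ((L - 1 : ℕ) : ℝ) * L ≤ L * L := mul_le_mul_of_nonneg_right hL1r (by positivity)
  have h0 : a₀ ≤ S := by
    have : (1 : ℝ) * a₀ ≤ L * L * a₀ := mul_le_mul_of_nonneg_right (by nlinarith) ha0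
    linarith
  have h1 : ((L - 1 : ℕ) : ℝ) * a₀ ≤ S := by
    have := mul_le_mul_of_nonneg_right hLL1 ha0; linarith
  have h2 : (L : ℝ) * a₀ ≤ S := by
    have := mul_le_mul_of_nonneg_right hLL2 ha0; linarith
  have h3 : ((L - 1 : ℕ) : ℝ) * L * a₀ ≤ S := by
    have := mul_le_mul_of_nonneg_right hLL3 ha0; linarith
  have hδd : 0 ≤ (d : ℝ) * ((L - 1 : ℕ) * δ) := by positivity
  have hδdL : 0 ≤ (d : ℝ) * (((L - 1 : ℕ) * L) * δ) := by positivity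
  have hθS : θ ≤ S := by linarith
  have hθLS : θL ≤ S := by linarith
  have hθθLS : θ + θL ≤ S := by linarith
  have hqμ := (hq μ).2
  have hqν := (hq ν).2
  by_cases hμ : q μ = (L : ℤ) - 1
  · by_cases hν : q ν = (L : ℤ) - 1
    · -- case IV
      refine (norm_plaq_corner_sub_root_le hL hT hh ha ha0 (hδ z) hδ0 hq hμν (hroot z μ ν hμν) hμ hν).trans ?_
      change (2 * (d * ((L - 1 : ℕ) * δ)) + 2 * (d * (((L - 1 : ℕ) * L) * δ)))
        + (2 * (θ + θL) * (θ + θL) + 2 * ((L - 1 : ℕ) * a₀) * (θ + θL) + 2 * (2 * θ + 3 * θL) * a₀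
          + 2 * (((L - 1 : ℕ) * L) * a₀) * (θ + 2 * θL))
        ≤ 2 * (d * ((L - 1 : ℕ) * δ)) + 2 * (d * (((L - 1 : ℕ) * L) * δ)) + 14 * S ^ 2
      nlinarith [mul_le_mul hθθLS hθθLS (by positivity) hS0,
        mul_le_mul h1 hθθLS (by positivity) hS0,
        mul_le_mul (show 2 * θ + 3 * θL ≤ 3 * S by linarith) h0 ha0 (by positivity),
        mul_le_mul h3 (show θ + 2 * θL ≤ 2 * S by linarith) (by positivity) hS0]
    · -- case II
      have hν' : q ν < (L : ℤ) - 1 := lt_of_le_of_ne (by omega) hν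
      refine (norm_plaq_farμ_sub_root_le hL hT hh ha ha0 (fun κ ι hκι => hδ z μ κ ι hκι) hδ0 hq hμν hμ hν').trans ?_
      change 2 * θ * θ + 2 * θ * a₀ + (2 * θL * θ + d * ((L - 1 : ℕ) * δ))
        ≤ 2 * (d * ((L - 1 : ℕ) * δ)) + 2 * (d * (((L - 1 : ℕ) * L) * δ)) + 14 * S ^ 2
      nlinarith [mul_le_mul hθS hθS hθ0 hS0, mul_le_mul hθS h0 ha0 hS0, mul_le_mul hθLS hθS hθ0 hS0]
  · have hμ' : q μ < (L : ℤ) - 1 := lt_of_le_of_ne (by omega) hμ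
    by_cases hν : q ν = (L : ℤ) - 1
    · -- case III
      refine (norm_plaq_farν_sub_root_le hL hT hh ha ha0 (fun κ ι hκι => hδ z ν κ ι hκι) hδ0 hq hμν hμ' hν).trans ?_
      change 2 * θ * (θ + θL) + 2 * (L * a₀) * (θL + θ) + d * ((L - 1 : ℕ) * δ) + 2 * (2 * θ + 3 * θL) * a₀
        ≤ 2 * (d * ((L - 1 : ℕ) * δ)) + 2 * (d * (((L - 1 : ℕ) * L) * δ)) + 14 * S ^ 2
      nlinarith [mul_le_mul hθS hθθLS (by positivity) hS0,
        mul_le_mul h2 (show θL + θ ≤ S by linarith) (by positivity) hS0,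
        mul_le_mul (show 2 * θ + 3 * θL ≤ 3 * S by linarith) h0 ha0 (by positivity)]
    · -- case I
      have hν' : q ν < (L : ℤ) - 1 := lt_of_le_of_ne (by omega) hν
      refine (norm_plaq_inner_sub_root_le (T := T) hh ha ha0 hq hμν hμ' hν').trans ?_
      change 2 * θ * θ + 2 * θ * a₀
        ≤ 2 * (d * ((L - 1 : ℕ) * δ)) + 2 * (d * (((L - 1 : ℕ) * L) * δ)) + 14 * S ^ 2
      nlinarith [mul_le_mul hθS hθS hθ0 hS0, mul_le_mul hθS h0 ha0 hS0]

/-- The same at an arbitrary fine site `x` (block coordinates `x = L•z + q`, root of the block `cdiv L x`). [folklore] -/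
theorem norm_plaq_sub_root_le' (hL : 1 ≤ L) {T : Site d → Fin d → (Matrix n n ℂ)ˣ}
    {h : Site d → Fin d → Fin d → (Matrix n n ℂ)ˣ}
    (hT : ∀ (z : Site d) (κ : Fin d), T z κ ∈ unitaryUnits (Matrix n n ℂ))
    (hh : ∀ (z : Site d) (κ ν : Fin d), h z κ ν ∈ unitaryUnits (Matrix n n ℂ))
    (ha : ∀ (z : Site d) (κ ν : Fin d), κ < ν → ‖((h z κ ν : (Matrix n n ℂ)ˣ) : Matrix n n ℂ) - 1‖ ≤ a₀) (ha0 : 0 ≤ a₀)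
    (hδ : ∀ (z : Site d) (ρ κ ι : Fin d), κ < ι →
      ‖((T z ρ * h (z + e ρ) κ ι * (T z ρ)⁻¹ : (Matrix n n ℂ)ˣ) : Matrix n n ℂ) - ((h z κ ι : (Matrix n n ℂ)ˣ) : Matrix n n ℂ)‖
        ≤ δ) (hδ0 : 0 ≤ δ)
    (hroot : ∀ (z : Site d) (κ ι : Fin d), κ < ι → (h z κ ι) ^ (L * L) = hol T z (plaqWord κ ι))
    (x : Site d) {μ ν : Fin d} (hμν : μ < ν) :
    ‖((hol (fullFill L T h) x (plaqWord μ ν) : (Matrix n n ℂ)ˣ) : Matrix n n ℂ)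
        - ((h (cdiv L x) μ ν : (Matrix n n ℂ)ˣ) : Matrix n n ℂ)‖
      ≤ 2 * (d * ((L - 1 : ℕ) * δ)) + 2 * (d * (((L - 1 : ℕ) * L) * δ))
        + 14 * (d * ((L - 1 : ℕ) * a₀) + d * (((L - 1 : ℕ) * L) * a₀) + L * L * a₀) ^ 2 := by
  have hq : InBox L (cmod L x) := fun i => ⟨cmod_nonneg hL x i, cmod_lt hL x i⟩
  rw [show hol (fullFill L T h) x (plaqWord μ ν) = hol (fullFill L T h) ((L : ℤ) • cdiv L x + cmod L x) (plaqWord μ ν) by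
    rw [smul_cdiv_add_cmod]]
  exact norm_plaq_sub_root_le hL hT hh ha ha0 hδ hδ0 hroot (cdiv L x) hq hμν

/-- **THE COVARIANT FLUX GRADIENT OF THE CLOSED-FORM FILLING, AT EVERY BOND AND PLANE** — the END of the F4 chain and the
fourth field of the R1 socket for `W := fullFill L T h`: for unitary data `T, h`, roots within `a₀` of `1`, covariant root
gradients `≤ δ` across every coarse bond, the root identity `h^{L²} = T(∂p)`, and the smallness `a₀ + ρ⋆ + δ ≤ 1/2`
(`ρ⋆ = 2d(L−1)δ + 2d(L−1)Lδ + 14S²`, `S = d(L−1)a₀ + d(L−1)La₀ + L²a₀`):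
`‖covGrad W (flux W) x κ π‖ ≤ 4(θ + θ_L)(a₀ + ρ⋆ + δ) + 2(2ρ⋆ + δ)`, `θ = d(L−1)a₀`, `θ_L = d(L−1)La₀` — first order in the
covariant root gradient, second order in the root radius, NO term linear in `a₀`. [folklore] -/
theorem covGrad_fullFill_le (hL : 1 ≤ L) {T : Site d → Fin d → (Matrix n n ℂ)ˣ}
    {h : Site d → Fin d → Fin d → (Matrix n n ℂ)ˣ}
    (hT : ∀ (z : Site d) (κ : Fin d), T z κ ∈ unitaryUnits (Matrix n n ℂ))
    (hh : ∀ (z : Site d) (κ ν : Fin d), h z κ ν ∈ unitaryUnits (Matrix n n ℂ))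
    (ha : ∀ (z : Site d) (κ ν : Fin d), κ < ν → ‖((h z κ ν : (Matrix n n ℂ)ˣ) : Matrix n n ℂ) - 1‖ ≤ a₀) (ha0 : 0 ≤ a₀)
    (hδ : ∀ (z : Site d) (ρ κ ι : Fin d), κ < ι →
      ‖((T z ρ * h (z + e ρ) κ ι * (T z ρ)⁻¹ : (Matrix n n ℂ)ˣ) : Matrix n n ℂ) - ((h z κ ι : (Matrix n n ℂ)ˣ) : Matrix n n ℂ)‖
        ≤ δ) (hδ0 : 0 ≤ δ)
    (hroot : ∀ (z : Site d) (κ ι : Fin d), κ < ι → (h z κ ι) ^ (L * L) = hol T z (plaqWord κ ι))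
    (hsmall : a₀ + (2 * (d * ((L - 1 : ℕ) * δ)) + 2 * (d * (((L - 1 : ℕ) * L) * δ))
        + 14 * (d * ((L - 1 : ℕ) * a₀) + d * (((L - 1 : ℕ) * L) * a₀) + L * L * a₀) ^ 2) + δ ≤ 1 / 2)
    (x : Site d) (κ : Fin d) (π : T4AveragingDeficitWall.Plane d) :
    ‖covGrad (fullFill L T h) (flux (fullFill L T h)) x κ π‖
      ≤ 4 * (d * ((L - 1 : ℕ) * a₀) + d * (((L - 1 : ℕ) * L) * a₀))
          * (a₀ + (2 * (d * ((L - 1 : ℕ) * δ)) + 2 * (d * (((L - 1 : ℕ) * L) * δ))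
            + 14 * (d * ((L - 1 : ℕ) * a₀) + d * (((L - 1 : ℕ) * L) * a₀) + L * L * a₀) ^ 2) + δ)
        + 2 * (2 * (2 * (d * ((L - 1 : ℕ) * δ)) + 2 * (d * (((L - 1 : ℕ) * L) * δ))
            + 14 * (d * ((L - 1 : ℕ) * a₀) + d * (((L - 1 : ℕ) * L) * a₀) + L * L * a₀) ^ 2) + δ) :=
  covGrad_fullFill_le_of_rootClose hL hT hh ha ha0 hδ hδ0
    (fun z _ _ _ hμν hq => norm_plaq_sub_root_le hL hT hh ha ha0 hδ hδ0 hroot z hq hμν) hsmall x κ π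

end End

end

end Summit.QuantumFields.BalabanUV.T4Continuum.SkeletonFillFullCovGrad
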